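import Mathlib
import Summits.ValiantsHypothesis.ValiantsHypothesis.Theorems.BarrierLeverPartitionMinorsHitByVPHiddenStatesFullJoinDoor

/-!
# Route BarrierLever — item `PartitionMinorsHitByVP` (stmt-ValiantsHypothesis-19717), line `hidden_states`:
# THE ONE-SIDED NODE — a UNIVERSAL THRESHOLD DESIGN (typed, not asserted) closes the item with `b = 8`

Helper file (`--supports stmt-ValiantsHypothesis-19717`; cell valiant-natproofs, rung V4, 𝒟-side door (c), line
`Cruxes/PartitionMinorsHitByVP/Lines/hidden_states.lean` v8; prover seat val-np-p3 gen 16). ONE typed statement (a `def … : Prop`,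
conjectural, NOT asserted) + its kernel-checked arrow to the item. Closes NO item.

THE POINT (memo val-np-p3 g16 «full join» §16). Every two-sided difficulty of the line (a threshold design good for the row family AND
the column family) disappears if ONE design per `(h, r)` is good for EVERY family: then rows and columns use the same design with their own
tables, the design's extremal `λ`-monomial isolates `det A · det B ≠ 0` (`fullJoin_det_ne_zero_of_threshold`, p672458), and the one-cube
door gives `f ∈ SmallCircuits ℂ (h+h) 8` (`partitionMinor_hit_of_fullJoin_mem`). `Stmt.universalThresholdDesign` types exactly that:
for `h ≥ h₁` and every `r ≤ 2^h` there are `K ≤ h³` states, an injective family `J : Fin r → Finset (Fin K)` which is a strict initial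
segment of a positive-integer weight order, such that for EVERY injective `u : Fin r → Finset (Fin h)` some block-additive table makes
`det[∏_{a∈u i}(tx₀ a + Σ_{q∈J k} tx_q a)]_{i,k} ≠ 0` (pure ONE-SIDED unisolvence: the points `tx₀ + Σ_{q∈J k} tx_q` interpolate the monomials
`x^{u i}`). `partitionMinorsHitByVP_of_universalThresholdDesign` is the arrow. NUMERICAL STATUS (this seat, lab/fj_flatwide*.py): the FLAT
COLEX design (`∅`, all singletons, then pairs, triples, … each layer in colex order) is good for every family tested as soon as `K` exceeds `h`
by a little: h = 4: all 65 535 families at K = 6 (and all 167 lower ones at K = 4); h = 5: all 7 580 lower families at K = 5, 8; h = 6: the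
only failure at K = 6 is `B₁(6) ∪ K_{1,5}` (the shadow obstruction of memo §4), cured at K = 7, 8, 12, with 0 / 800 random lower+general
failures; h = 7: K = 7 fails on `B₁ ∪ K_{1,5}`, `B₁ ∪ K_{1,6}`, `cl K_{2,5}`, K = 8 on `B₁ ∪ K_{1,6}`, K = 10 on nothing (0 / 240 random).
CONJECTURE (UTD-flat): the flat colex design with `K = h²` states is universal. WHY IT MIGHT FAIL: a family whose level structure beats the
slack of the flat design at some `K ≤ h³` for large `r` (the tests reach r ≤ 64); then a non-flat universal design may still exist, and
failing that the two-sided conjecture FJ (`Stmt.fullJoinCube[Wide]`) remains.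
-/

set_option linter.dupNamespace false

namespace Summit.ValiantsHypothesis.ValiantsHypothesis.Theorems.BarrierLever.HiddenStates

open Finset Matrix
open Literature.Barriers.ValiantsHypothesis

noncomputable section

namespace FullJoin

/-- **Universal threshold design (typed; not asserted) — conjecture UTD.** Eventually in `h`, for every `r ≤ 2^h` there is ONE design —
`K ≤ h³` states and an injective state-set family `J : Fin r → Finset (Fin K)` that is a strict initial segment of a weight order
(`wt : Fin K → ℕ`: every state set outside the family is strictly heavier than every member) — which is GOOD FOR EVERY ROW FAMILY: for
each injective `u : Fin r → Finset (Fin h)` some block-additive table `tx` has `det[∏_{a ∈ u i} (tx none a + Σ_{q ∈ J k} tx (some q) a)]_{i,k} ≠ 0`.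
Candidate: the flat colex design with `K = h²` (module docstring). -/
def Stmt.universalThresholdDesign : Prop :=
  ∃ h₁ : ℕ, ∀ h : ℕ, h₁ ≤ h → ∀ r : ℕ, r ≤ 2 ^ h →
    ∃ (K : ℕ) (J : Fin r → Finset (Fin K)) (wt : Fin K → ℕ), K ≤ h * h * h ∧ Function.Injective J ∧
      (∀ J' : Finset (Fin K), J' ∉ Set.range J → ∀ k : Fin r, ∑ q ∈ J k, wt q < ∑ q ∈ J', wt q) ∧
      ∀ u : Fin r → Finset (Fin h), Function.Injective u →
        ∃ tx : Option (Fin K) → Fin h → ℂ,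
          (Matrix.of fun i k : Fin r => ∏ a ∈ u i, (tx none a + ∑ q ∈ J k, tx (some q) a)).det ≠ 0

/-- An injective family of subsets of `Fin h` indexed by `Fin r` forces `r ≤ 2^h`. -/
theorem le_two_pow_of_injective {h r : ℕ} (u : Fin r → Finset (Fin h)) (hu : Function.Injective u) : r ≤ 2 ^ h := by
  have := Fintype.card_le_of_injective u hu
  simpa [Fintype.card_fin, Fintype.card_finset] using this

/-- **The one-sided node closes the item** (`b = 8`): rows and columns use the SAME universal design with their own tables; the design's
extremal weight monomial isolates `det A · det B ≠ 0` (`fullJoin_det_ne_zero_of_threshold`), and the one-cube door lands the witness in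
`SmallCircuits ℂ (h + h) 8`. -/
theorem partitionMinorsHitByVP_of_universalThresholdDesign (H : Stmt.universalThresholdDesign) :
    Summit.ValiantsHypothesis.ValiantsHypothesis.Theses.BarrierLever.PartitionMinorsHitByVP := by
  classical
  obtain ⟨h₁, H⟩ := H
  refine ⟨8, max h₁ 3, fun h hh r u w hu hw => ?_⟩
  have hh₁ : h₁ ≤ h := le_trans (le_max_left _ _) hh
  have hh3 : 3 ≤ h := le_trans (le_max_right _ _) hh
  obtain ⟨K, J, wt, hK, hJ, hthr, hgood⟩ := H h hh₁ r (le_two_pow_of_injective u hu)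
  obtain ⟨tx, hx⟩ := hgood u hu
  obtain ⟨ty, hy⟩ := hgood w hw
  -- the threshold lemma with one cube
  have hthr' : ∀ x : Fin 1 × Finset (Fin K), x ∉ Set.range (fun k : Fin r => ((0 : Fin 1), J k)) →
      ∀ i : Fin r, (fun _ : Fin 1 => (0 : ℕ)) ((fun k : Fin r => ((0 : Fin 1), J k)) i).1 +
          ∑ q ∈ ((fun k : Fin r => ((0 : Fin 1), J k)) i).2, (fun (_ : Fin 1) (q : Fin K) => wt q) ((fun k : Fin r => ((0 : Fin 1), J k)) i).1 q <
        (fun _ : Fin 1 => (0 : ℕ)) x.1 + ∑ q ∈ x.2, (fun (_ : Fin 1) (q : Fin K) => wt q) x.1 q := by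
    intro x hx' i
    have hx2 : x.2 ∉ Set.range J := by
      rintro ⟨k, hk⟩
      apply hx'
      refine ⟨k, ?_⟩
      ext
      · simp [Subsingleton.elim x.1 0]
      · simp [hk]
    simpa using hthr x.2 hx2 i
  have he : Function.Injective (fun k : Fin r => ((0 : Fin 1), J k)) := fun k k' hkk' => hJ (by simpa using hkk')
  obtain ⟨t₀, hdet⟩ := fullJoin_det_ne_zero_of_threshold h 1 K r u w (fun k => ((0 : Fin 1), J k)) he (fun _ => 0)
    (fun _ q => wt q) hthr' (fun _ => tx) (fun _ => ty) (by simpa using hx) (by simpa using hy)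
  refine partitionMinor_hit_of_fullJoin_mem h 1 K r hh3 (by omega) hK u w (fun _ => tx) (fun _ => ty) (fun p => t₀ ^ (0 : ℕ))
    (fun _ q => t₀ ^ wt q) ?_
  simpa using hdet

end FullJoin

end

end Summit.ValiantsHypothesis.ValiantsHypothesis.Theorems.BarrierLever.HiddenStates
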